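import Literature.NumberTheory.EllipticCurves.GreenbergSelmerCofreeReductionPkProofs
import Literature.NumberTheory.EllipticCurves.TateModule
import Literature.NumberTheory.EllipticCurves.ComplexMultiplicationHasCMProofs
import Summits.BirchSwinnertonDyer.BirchSwinnertonDyer.Theorems.ThetaPartnerAtTwoSignedTransportAtTwoResidualRank
import HarnessLib

/-!
# U52 (a): the number `n` of `Θ`-coordinates IS `f = [𝒪 : ℤ₂]` — `n_eq_of_theta` — by counting `2`-torsion on both sides of
# `Θ : A_ρ ≃+ (Fin n → E[2^∞])` (`#A_ρ[2] = #(𝒪/2)² = 2^{2f}`, `#E[2^∞][2] = 4`)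

Route `ResidualThetaTransportAtTwo` (RTT), crux RSL_g `ResidualSignedLambdaLowerCMAtTwo` (stmt-BirchSwinnertonDyer-22608); seat
`prover-bsd-wall-tp2-p2x` g17 (`--supports 22608 --as helper`, closes nothing). THEOREMS ONLY (no definition, no named fact, no instance,
no `sorry`). STUB-PLAN rev 17/18 **S73 / Q74**: the k4-g14 card's §C/§C′ (`Cruxes/ResidualThetaCountLowerPureAtTwo/Sketch_sidea_k4_g14.lean`,
0b26c34dcc298734, kernel-checked by the critic) ported VERBATIM — in the kernel ASSEMBLY of `stub_onePairSupply` / the split glue one writes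
`have hnf : n = f := n_eq_of_theta (Set.range ι) ρ W B (Θ v₂ hv₂); subst hnf`, so that `Fin n` IS `Fin f` (trap T44: `n = f` is NECESSARY for
the Coleman-side injectivity, O1′).

* §1 abstract: `mem_torsionBy_iff'`, `natCard_torsionBy_pi` (`#(Bⁿ)[m] = (#B[m])ⁿ`), `eq_of_addEquiv_pi_of_natCard_torsionBy`;
* §2 registered currency: `natCard_torsionBy_cofree` (`#A_ρ[p^k] = #(𝒪/p^k)^m`, from `divPowCofreeMkTorsion_surjective` + `divPowCofreeMk_eq_iff`),
  `natCard_torsionBy_geomPrimaryTorsion` (`#E[p^∞][p] = p²`), (`#(ℤ_p/p) = p` is the tree's `SignedTransportAtTwo.natCard_padicInt_quotient_span`),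
  `natCard_quotient_span_natCast_of_addEquiv` (`#(𝒪/q) = #(ℤ_p/q)^f` along an ADDITIVE basis `B : ℤ_p^f ≃+ 𝒪`), **`two_mul_eq_mul_of_theta`**
  (`2·n = m·f` for rank `m`), **`n_eq_of_theta`** (`m = 2`: `n = f`).

Credit: card `stub-cmlambdalower-k4-g14` (stub-ideation k4 g14). References: [SilvermanAEC2009] III Cor. 6.4 (b) (`#E[n] = n²`); Greenberg,
LNM 1716 §2 (`A = V/T`, `A[p^k] ≅ T/p^k T`). BSD is not proved by any of this; RSL_g is not proved here.
-/

set_option autoImplicit false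
-- the Theorems namespace of this sub repeats the summit name by design (D-0017 nested layout)
set_option linter.dupNamespace false

noncomputable section

namespace Summit.BirchSwinnertonDyer.BirchSwinnertonDyer.Theorems

namespace ThetaTransport.CofreeTorsionCount

universe u v w

/-! ## §1 Abstract count: `Θ : A ≃+ (Fin n → B)` with `#A[2] = 2^{2f}`, `#B[2] = 4` forces `n = f` -/

section Count

variable {A : Type u} {B : Type v} [AddCommGroup A] [AddCommGroup B]

/-- Membership in the `n`-torsion subgroup. [folklore] -/
theorem mem_torsionBy_iff' (C : Type w) [AddCommGroup C] (n : ℤ) (x : C) :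
    x ∈ AddSubgroup.torsionBy C n ↔ n • x = 0 :=
  Submodule.mem_torsionBy_iff (R := ℤ) n x

/-- `#(Bⁿ)[m] = (#B[m])ⁿ`. [folklore] -/
theorem natCard_torsionBy_pi (k : ℕ) (m : ℤ) :
    Nat.card (AddSubgroup.torsionBy (Fin k → B) m) = Nat.card (AddSubgroup.torsionBy B m) ^ k := by
  have e : AddSubgroup.torsionBy (Fin k → B) m ≃ (Fin k → AddSubgroup.torsionBy B m) :=
    (Equiv.subtypeEquivRight (p := fun g : Fin k → B ↦ g ∈ AddSubgroup.torsionBy (Fin k → B) m)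
        (q := fun g : Fin k → B ↦ ∀ i, g i ∈ AddSubgroup.torsionBy B m) fun g ↦ by
          simp only [mem_torsionBy_iff', funext_iff, Pi.smul_apply, Pi.zero_apply]).trans
      (Equiv.subtypePiEquivPi (p := fun _ b ↦ b ∈ AddSubgroup.torsionBy B m))
  rw [Nat.card_congr e, Nat.card_pi, Finset.prod_const, Finset.card_univ, Fintype.card_fin]

/-- **U52 (a), abstract form: an additive equivalence `A ≃+ (Fin n → B)` with `#A[2] = 2^{2f}` and `#B[2] = 4` forces `n = f`.**
(For RSL_g: `A = Cofree ρ F` has `#A[2] = #(T_ρ/2T_ρ) = #(𝒪/2)² = 2^{2[𝒪:ℤ₂]}`, `B = W[2^∞]` has `#B[2] = 4`, so the number `n` of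
`Θ`-coordinates IS `[𝒪:ℤ₂]`, the `f` of the supply's basis `B : ℤ₂^f ≃+ 𝒪`.) [folklore] -/
theorem eq_of_addEquiv_pi_of_natCard_torsionBy {n f : ℕ} (e : A ≃+ (Fin n → B))
    (hA : Nat.card (AddSubgroup.torsionBy A 2) = 2 ^ (2 * f))
    (hB : Nat.card (AddSubgroup.torsionBy B 2) = 4) : n = f := by
  have h1 : Nat.card (AddSubgroup.torsionBy A 2) = Nat.card (AddSubgroup.torsionBy (Fin n → B) 2) := by
    refine Nat.card_congr (e.toEquiv.subtypeEquiv fun a ↦ ?_)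
    rw [mem_torsionBy_iff', mem_torsionBy_iff', AddEquiv.toEquiv_eq_coe, AddEquiv.coe_toEquiv, ← map_zsmul,
      e.map_eq_zero_iff]
  rw [h1, natCard_torsionBy_pi, hB, show (4 : ℕ) = 2 ^ 2 by norm_num, ← pow_mul] at hA
  have := Nat.pow_right_injective (le_refl 2) hA
  omega

end Count


/-! ## §2 U52 (a) in the REGISTERED currency: `#A_ρ[p^k] = #(𝒪/p^k)^m`, `#E[p^∞][p] = p²`, `#(𝒪/q) = #(ℤ_p/q)^f`, `n = f` -/

section RegisteredCount

open Literature.NumberTheory.EllipticCurves Literature.NumberTheory.EllipticCurves.GreenbergSelmer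
  Literature.NumberTheory.GaloisRepresentations
open SignedTransportAtTwo (natCard_padicInt_quotient_span)

/-- **`#A_ρ[p^k] = #(𝒪/p^k 𝒪)^m`** for `A_ρ = Cofree ρ F = Fⁿ/𝒪ⁿ` (`F = ℚ_p(S)`, `𝒪` its integers, `ρ` framed of rank `m`):
the tree's `divPowCofreeMkTorsion S ρ k : 𝒪^m →+ A_ρ[p^k]` is onto (`divPowCofreeMkTorsion_surjective`) with fibres the cosets of
`p^k 𝒪^m` (`divPowCofreeMk_eq_iff`), so `A_ρ[p^k] ≃ (𝒪/p^k)^m` as sets. [folklore] -/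
theorem natCard_torsionBy_cofree {p : ℕ} [Fact p.Prime] (S : Set (PadicAlgCl p)) {m : ℕ}
    (ρ : FramedGaloisRep ℚ (padicCoeffIntegers S) m) (k : ℕ) :
    Nat.card (AddSubgroup.torsionBy (Cofree ρ (padicCoeffField S)) ((p ^ k : ℕ) : ℤ)) =
      Nat.card (padicCoeffIntegers S ⧸ Ideal.span {((p : padicCoeffIntegers S)) ^ k}) ^ m := by
  classical
  set I : Ideal (padicCoeffIntegers S) := Ideal.span {((p : padicCoeffIntegers S)) ^ k} with hI
  have hsurj := divPowCofreeMkTorsion_surjective S ρ k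
  let red : (Fin m → padicCoeffIntegers S) → (Fin m → padicCoeffIntegers S ⧸ I) := fun t i ↦ Ideal.Quotient.mk I (t i)
  have hred : ∀ t t', red t = red t' ↔ divPowCofreeMk S ρ k t = divPowCofreeMk S ρ k t' := by
    intro t t'
    rw [divPowCofreeMk_eq_iff, funext_iff]
    exact forall_congr' fun i ↦ Ideal.Quotient.eq
  let ψ : AddSubgroup.torsionBy (Cofree ρ (padicCoeffField S)) ((p ^ k : ℕ) : ℤ) → (Fin m → padicCoeffIntegers S ⧸ I) :=
    fun a ↦ red (Function.surjInv hsurj a)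
  have hψ : Function.Bijective ψ := by
    constructor
    · intro a a' h
      have h' := (hred _ _).mp h
      rw [← coe_divPowCofreeMkTorsion_apply, ← coe_divPowCofreeMkTorsion_apply, Function.surjInv_eq hsurj,
        Function.surjInv_eq hsurj] at h'
      exact Subtype.ext h'
    · intro q
      obtain ⟨t, ht⟩ : ∃ t : Fin m → padicCoeffIntegers S, red t = q := by
        choose t ht using fun i ↦ Ideal.Quotient.mk_surjective (q i)
        exact ⟨t, funext ht⟩
      refine ⟨divPowCofreeMkTorsion S ρ k t, ?_⟩
      rw [← ht]
      show red _ = red t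
      rw [hred, ← coe_divPowCofreeMkTorsion_apply, ← coe_divPowCofreeMkTorsion_apply, Function.surjInv_eq hsurj]
  rw [Nat.card_congr (Equiv.ofBijective ψ hψ), Nat.card_pi, Finset.prod_const, Finset.card_univ, Fintype.card_fin]

/-- **`#E[p^∞][p] = p²`** (`char K = 0`): the `p`-torsion of the `p`-primary part `E[p^∞] ⊆ E(K̄)` is `E[p]` (same points), counted
by the tree's `WeierstrassCurve.natCard_torsionBy_geomPoints`. [cite: SilvermanAEC2009, III Cor. 6.4 (b)] -/
theorem natCard_torsionBy_geomPrimaryTorsion {K : Type u} [Field K] [CharZero K] (W : WeierstrassCurve K) [W.IsElliptic]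
    (p : ℕ) (hp : p ≠ 0) :
    Nat.card (AddSubgroup.torsionBy (W.geomPrimaryTorsion p) (p : ℤ)) = p ^ 2 := by
  have key : ∀ P : W.geomPoints, (p : ℤ) • P = 0 → P ∈ W.geomPrimaryTorsion p := fun P hP ↦
    (AddCommGroup.mem_primaryComponent).mpr ⟨1, by rw [pow_one, ← natCast_zsmul]; exact hP⟩
  have e : AddSubgroup.torsionBy (W.geomPrimaryTorsion p) (p : ℤ) ≃ AddSubgroup.torsionBy W.geomPoints (p : ℤ) :=
    { toFun := fun m ↦ ⟨(m.1 : W.geomPoints), by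
        rw [mem_torsionBy_iff', ← AddSubgroupClass.coe_zsmul, (mem_torsionBy_iff' _ _ m.1).mp m.2,
          ZeroMemClass.coe_zero]⟩
      invFun := fun P ↦ ⟨⟨P.1, key P.1 ((mem_torsionBy_iff' _ _ P.1).mp P.2)⟩, by
        rw [mem_torsionBy_iff', Subtype.ext_iff, AddSubgroupClass.coe_zsmul, ZeroMemClass.coe_zero]
        exact (mem_torsionBy_iff' _ _ P.1).mp P.2⟩
      left_inv := fun m ↦ rfl
      right_inv := fun P ↦ rfl }
  rw [Nat.card_congr e, WeierstrassCurve.natCard_torsionBy_geomPoints (W := W) (by exact_mod_cast hp), Int.natAbs_natCast]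

/-- **`#(𝒪/q𝒪) = #(ℤ_p/q)^f` along an ADDITIVE basis `B : ℤ_p^f ≃+ 𝒪`** (the `f` of the supply's binder): `B` carries `q·ℤ_p^f` onto
`q𝒪` (additivity alone), the quotient of a product is the product of quotients. [folklore] -/
theorem natCard_quotient_span_natCast_of_addEquiv {p : ℕ} [Fact p.Prime] {𝒪 : Type u} [CommRing 𝒪] {f : ℕ} (q : ℕ)
    (B : (Fin f → ℤ_[p]) ≃+ 𝒪) :
    Nat.card (𝒪 ⧸ Ideal.span {(q : 𝒪)}) = Nat.card (ℤ_[p] ⧸ Ideal.span {(q : ℤ_[p])}) ^ f := by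
  classical
  set I : Ideal 𝒪 := Ideal.span {(q : 𝒪)} with hI
  set J : Ideal ℤ_[p] := Ideal.span {(q : ℤ_[p])} with hJ
  let e₁ : (𝒪 ⧸ I.restrictScalars ℤ) ≃ₗ[ℤ] 𝒪 ⧸ I := Submodule.Quotient.restrictScalarsEquiv ℤ I
  let L : (Fin f → ℤ_[p]) ≃ₗ[ℤ] 𝒪 := B.toIntLinearEquiv
  have hmap : (Submodule.pi Set.univ fun _ : Fin f ↦ J.restrictScalars ℤ).map (L : (Fin f → ℤ_[p]) →ₗ[ℤ] 𝒪) =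
      I.restrictScalars ℤ := by
    ext x
    simp only [Submodule.mem_map, Submodule.mem_pi, Set.mem_univ, true_implies, Submodule.restrictScalars_mem, hJ, hI,
      Ideal.mem_span_singleton']
    constructor
    · rintro ⟨y, hy, rfl⟩
      choose w hw using hy
      refine ⟨B w, ?_⟩
      have hyw : y = q • w := funext fun i ↦ by rw [Pi.smul_apply, nsmul_eq_mul, ← hw i, mul_comm]
      rw [hyw]
      change B w * q = B (q • w)
      rw [map_nsmul, nsmul_eq_mul, mul_comm]
    · rintro ⟨a, rfl⟩
      refine ⟨q • B.symm a, fun i ↦ ⟨B.symm a i, by rw [Pi.smul_apply, nsmul_eq_mul, mul_comm]⟩, ?_⟩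
      change B (q • B.symm a) = a * q
      rw [map_nsmul, B.apply_symm_apply, nsmul_eq_mul, mul_comm]
  let e₂ := Submodule.Quotient.equiv (Submodule.pi Set.univ fun _ : Fin f ↦ J.restrictScalars ℤ) (I.restrictScalars ℤ) L hmap
  let e₃ := Submodule.quotientPi (R := ℤ) (fun _ : Fin f ↦ J.restrictScalars ℤ)
  let e₄ : (ℤ_[p] ⧸ J.restrictScalars ℤ) ≃ₗ[ℤ] ℤ_[p] ⧸ J := Submodule.Quotient.restrictScalarsEquiv ℤ J
  rw [← Nat.card_congr e₁.toEquiv, ← Nat.card_congr e₂.toEquiv, Nat.card_congr e₃.toEquiv, Nat.card_pi,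
    Finset.prod_const, Finset.card_univ, Fintype.card_fin, Nat.card_congr e₄.toEquiv]

/-- **U52 (a) — `n = f` is FORCED by `Θ` (registered currency, no side facts left).** For a framed `ρ : Γ_ℚ → GL_m(𝒪)`,
`𝒪 = 𝒪_{ℚ₂(S)}` with additive basis `B : ℤ₂^f ≃+ 𝒪`, and ONE additive identification `Θ : A_ρ ≃+ (Fin n → E[2^∞])`
(`E/K`, `char K = 0`): `2·n = m·f`; for the curve's `ρ` (`m = 2`): `n = f`. Counting `2`-torsion on both sides:
`#A_ρ[2] = #(𝒪/2)^m = 2^{fm}` (`natCard_torsionBy_cofree`, `natCard_quotient_span_natCast_of_addEquiv`,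
`natCard_padicInt_quotient_span`) and `#E[2^∞][2]ⁿ = 4ⁿ` (`natCard_torsionBy_geomPrimaryTorsion`). [folklore] -/
theorem two_mul_eq_mul_of_theta (S : Set (PadicAlgCl 2)) {m : ℕ} (ρ : FramedGaloisRep ℚ (padicCoeffIntegers S) m)
    {K : Type u} [Field K] [CharZero K] (W : WeierstrassCurve K) [W.IsElliptic] {n f : ℕ}
    (B : (Fin f → ℤ_[2]) ≃+ padicCoeffIntegers S) (Θ : Cofree ρ (padicCoeffField S) ≃+ (Fin n → W.geomPrimaryTorsion 2)) :
    2 * n = m * f := by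
  -- `#A_ρ[2] = 2^{m f}`
  have hA : Nat.card (AddSubgroup.torsionBy (Cofree ρ (padicCoeffField S)) 2) = 2 ^ (m * f) := by
    have h := natCard_torsionBy_cofree S ρ 1
    rw [show (((2 ^ 1 : ℕ) : ℤ)) = 2 by norm_num, pow_one,
      show ((2 : ℕ) : padicCoeffIntegers S) = ((2 : ℕ) : padicCoeffIntegers S) from rfl,
      natCard_quotient_span_natCast_of_addEquiv 2 B, natCard_padicInt_quotient_span, ← pow_mul, mul_comm f m] at h
    exact h
  -- `#(Fin n → E[2^∞])[2] = 4ⁿ`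
  have hB : Nat.card (AddSubgroup.torsionBy (W.geomPrimaryTorsion 2) 2) = 4 := by
    have h := natCard_torsionBy_geomPrimaryTorsion W 2 two_ne_zero
    norm_num at h
    exact h
  have h1 : Nat.card (AddSubgroup.torsionBy (Cofree ρ (padicCoeffField S)) 2) =
      Nat.card (AddSubgroup.torsionBy (Fin n → W.geomPrimaryTorsion 2) 2) := by
    refine Nat.card_congr (Θ.toEquiv.subtypeEquiv fun a ↦ ?_)
    rw [mem_torsionBy_iff', mem_torsionBy_iff', AddEquiv.toEquiv_eq_coe, AddEquiv.coe_toEquiv, ← map_zsmul,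
      Θ.map_eq_zero_iff]
  rw [h1, natCard_torsionBy_pi, hB, show (4 : ℕ) = 2 ^ 2 by norm_num, ← pow_mul] at hA
  have := Nat.pow_right_injective (le_refl 2) hA
  omega

/-- **U52 (a) for the curve's representation (`m = 2`): `n = f`.** [folklore] -/
theorem n_eq_of_theta (S : Set (PadicAlgCl 2)) (ρ : FramedGaloisRep ℚ (padicCoeffIntegers S) 2)
    {K : Type u} [Field K] [CharZero K] (W : WeierstrassCurve K) [W.IsElliptic] {n f : ℕ}
    (B : (Fin f → ℤ_[2]) ≃+ padicCoeffIntegers S) (Θ : Cofree ρ (padicCoeffField S) ≃+ (Fin n → W.geomPrimaryTorsion 2)) :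
    n = f := by
  have := two_mul_eq_mul_of_theta S ρ W B Θ
  omega

end RegisteredCount

end ThetaTransport.CofreeTorsionCount

end Summit.BirchSwinnertonDyer.BirchSwinnertonDyer.Theorems

end
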